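import Summits.MatrixMultiplication.MatrixMultiplication.Theses.ReesMunnRealization
import Literature.Computability.AlgebraicComplexity.CohnUmansTPPProofs
import Literature.Computability.AlgebraicComplexity.MatMulMonomialSubrank
import HarnessLib

/-!
# Route ReesMunnRealization — `BlockRestrictionBound` (item stmt-MatrixMultiplication-4374)

The Cohn–Umans block inequality in pure tensor (restriction) form: if the matrix multiplication
tensor `⟨a,b,e⟩` is a restriction of a direct sum `⊕ᵢ ⟨dᵢ,dᵢ,dᵢ⟩` of square matrix
multiplication tensors (`dᵢ ≥ 1`), then `(abe)^{ω/3} ≤ ∑ᵢ dᵢ^ω` (`ω = ω(ℂ)`).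

The proof is that of Cohn–Umans 2003, Thm. 4.1 (= CKSU 2005, Thm. 1.8), as formalised in
`Literature.Computability.AlgebraicComplexity.CohnUmansTPPProofs`
(`rpow_omega_le_sum_blockDegrees_rpow`), with the group algebra replaced by the restriction
hypothesis:

1. rank form (`tensorRank_matMulTensor_pow_le_of_restrictsTo_matMulDirectSum`): for every `N`,
   `R(⟨a^N, b^N, e^N⟩) ≤ R(⟨a,b,e⟩^{⊗N}) ≤ R((⊕ᵢ ⟨dᵢ⟩)^{⊗N}) ≤ ∑_{J : Fin N → Fin p} R(⟨∏ₗ d_{J l}⟩)`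
   (`tensorMonRestrictsTo_kroneckerPow_matMulTensor`, `TensorRestrictsTo.kroneckerPow`,
   `kroneckerPow_matMulDirectSum`, `tensorRank_sum_le`, `tensorRank_blockPiTensor_le`);
2. `(a^N b^N e^N)^{ω/3} ≤ R(⟨a^N,b^N,e^N⟩)` (`rpow_omega_div_three_le_tensorRank`) and
   `R(⟨D,D,D⟩) ≤ C_ε D^{ω+ε}` (`exists_tensorRank_matMulTensor_le_rpow`), so
   `((abe)^{ω/3})^N ≤ C_ε (∑ᵢ dᵢ^{ω+ε})^N`; `N`-th roots and `N → ∞` (`le_of_pow_le_mul_pow`),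
   then `ε → 0` (`le_of_forall_pos_le_sum_rpow`).

Degenerate cases: `abe = 0` (`0^{ω/3} = 0`), and `p = 0` (then the rank form at `N = 1` reads
`R(⟨a,b,e⟩) ≤ 0`).

References: [CohnUmans2003, Thm. 4.1 (proof)], [CohnKleinbergSzegedyUmans2005, Thm. 1.8],
[BurgisserClausenShokrollahi1997, Prop. 15.1, 15.5], [Blaser2013, Thm. 5.9].
-/

noncomputable section

open scoped BigOperators

-- `Summit.<Summit>.<Problem>` is the tree's mandated summit-side namespace; for this
-- single-conjunct summit the two coincide, so the file silences `dupNamespace`.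
set_option linter.dupNamespace false

namespace Summit.MatrixMultiplication.MatrixMultiplication.Theorems

open Literature.Computability.AlgebraicComplexity
open Summit.MatrixMultiplication.MatrixMultiplication.Theses.ReesMunnRealization

/-- **Rank form of `⟨a,b,e⟩ ≤ ⊕ᵢ ⟨dᵢ,dᵢ,dᵢ⟩` under tensor powers** (Cohn–Umans 2003, proof of
Thm. 4.1, "taking the rank of both sides", with the group algebra replaced by an arbitrary
restriction): if `⊕ᵢ ⟨dᵢ,dᵢ,dᵢ⟩ ≥ ⟨a,b,e⟩` (`dᵢ ≥ 1`) then for every `N`,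
`R(⟨a^N, b^N, e^N⟩) ≤ ∑_{J : Fin N → Fin p} R(⟨∏ₗ d_{J l}, ∏ₗ d_{J l}, ∏ₗ d_{J l}⟩)`. -/
theorem tensorRank_matMulTensor_pow_le_of_restrictsTo_matMulDirectSum {p : ℕ} (d : Fin p → ℕ)
    [∀ i, NeZero (d i)] {a b e : ℕ}
    (h : TensorRestrictsTo (matMulDirectSum ℂ d d d) (matMulTensor ℂ a b e)) (N : ℕ) :
    tensorRank (matMulTensor ℂ (a ^ N) (b ^ N) (e ^ N)) ≤
      ∑ J : Fin N → Fin p,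
        tensorRank (matMulTensor ℂ (∏ l, d (J l)) (∏ l, d (J l)) (∏ l, d (J l))) := by
  calc tensorRank (matMulTensor ℂ (a ^ N) (b ^ N) (e ^ N))
      ≤ tensorRank (kroneckerPow (matMulTensor ℂ a b e) N) :=
        (tensorMonRestrictsTo_kroneckerPow_matMulTensor ℂ a b e N).tensorRestrictsTo.tensorRank_le
    _ ≤ tensorRank (kroneckerPow (matMulDirectSum ℂ d d d) N) := (h.kroneckerPow N).tensorRank_le
    _ = tensorRank (∑ J : Fin N → Fin p, blockPiTensor ℂ d J) := by
        rw [kroneckerPow_matMulDirectSum ℂ d N]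
    _ ≤ ∑ J : Fin N → Fin p, tensorRank (blockPiTensor ℂ d J) := tensorRank_sum_le _ _
    _ ≤ _ := Finset.sum_le_sum fun J _ => tensorRank_blockPiTensor_le ℂ d J

/-- **`BlockRestrictionBound`** (route ReesMunnRealization, item stmt-MatrixMultiplication-4374):
the Cohn–Umans inequality in pure tensor form — if `⟨a,b,e⟩ ≤ ⊕ᵢ ⟨dᵢ,dᵢ,dᵢ⟩` with all `dᵢ ≥ 1`
then `(abe)^{ω/3} ≤ ∑ᵢ dᵢ^ω`. Proof of Cohn–Umans 2003, Thm. 4.1 with the group replaced by the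
restriction hypothesis: tensor powers, ranks, `N`-th roots, `ε → 0`. -/
theorem blockRestrictionBound_proof : BlockRestrictionBound := by
  unfold BlockRestrictionBound
  intro p d a b e hd hres
  classical
  haveI : ∀ i, NeZero (d i) := fun i => ⟨Nat.one_le_iff_ne_zero.1 (hd i)⟩
  have hω0 : 0 < omega ℂ := zero_lt_two.trans_le (omega_two_le (K := ℂ))
  have hdpos : ∀ i, (0 : ℝ) < d i := fun i => by exact_mod_cast hd i
  rcases Nat.eq_zero_or_pos (a * b * e) with hq | hq
  · -- `abe = 0`
    rw [hq, Nat.cast_zero, Real.zero_rpow (div_pos hω0 three_pos).ne']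
    exact Finset.sum_nonneg fun i _ => Real.rpow_nonneg (Nat.cast_nonneg _) _
  rcases Nat.eq_zero_or_pos p with hp | hp
  · -- `p = 0`: the rank form at `N = 1` reads `R(⟨a,b,e⟩) ≤ 0`, while `(abe)^{ω/3} ≤ R(⟨a,b,e⟩)`
    subst hp
    have h1 := tensorRank_matMulTensor_pow_le_of_restrictsTo_matMulDirectSum d hres 1
    simp only [Finset.univ_eq_empty, Finset.sum_empty, nonpos_iff_eq_zero] at h1
    have hq1 : 1 ≤ a ^ 1 * b ^ 1 * e ^ 1 := by simpa only [pow_one] using Nat.one_le_of_lt hq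
    have h2 := rpow_omega_div_three_le_tensorRank ℂ hq1
    rw [h1, Nat.cast_zero] at h2
    simp only [pow_one] at h2
    simp only [Finset.univ_eq_empty, Finset.sum_empty]
    exact h2
  -- `p ≥ 1`, `abe ≥ 1`: the tensor-power argument, for every `ε > 0`
  refine le_of_forall_pos_le_sum_rpow hdpos fun ε hε => ?_
  obtain ⟨C, -, hCk⟩ := exists_tensorRank_matMulTensor_le_rpow ℂ hε
  have hb : 0 < ∑ i, (d i : ℝ) ^ (omega ℂ + ε) := by
    have hr : (Finset.univ : Finset (Fin p)).Nonempty :=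
      Finset.univ_nonempty_iff.2 ⟨⟨0, hp⟩⟩
    exact Finset.sum_pos (fun i _ => Real.rpow_pos_of_pos (hdpos i) _) hr
  refine le_of_pow_le_mul_pow (C := C) hb fun N => ?_
  have hDJ : ∀ J : Fin N → Fin p, 1 ≤ ∏ l, d (J l) := fun J =>
    Finset.prod_pos fun l _ => Nat.pos_of_ne_zero (NeZero.ne _)
  -- `(abe)^{Nω/3} ≤ R(⟨a^N, b^N, e^N⟩)`
  have hqN : 1 ≤ a ^ N * b ^ N * e ^ N := by
    rw [← mul_pow, ← mul_pow]; exact Nat.one_le_pow _ _ hq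
  have hx : (0 : ℝ) ≤ ((a * b * e : ℕ) : ℝ) := Nat.cast_nonneg _
  have hcast : ((a ^ N * b ^ N * e ^ N : ℕ) : ℝ) = ((a * b * e : ℕ) : ℝ) ^ N := by
    push_cast
    ring
  have hpow : (((a * b * e : ℕ) : ℝ) ^ N) ^ (omega ℂ / 3) =
      (((a * b * e : ℕ) : ℝ) ^ (omega ℂ / 3)) ^ N := by
    rw [← Real.rpow_natCast ((a * b * e : ℕ) : ℝ) N,
      ← Real.rpow_natCast (((a * b * e : ℕ) : ℝ) ^ (omega ℂ / 3)) N, ← Real.rpow_mul hx,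
      ← Real.rpow_mul hx, mul_comm (N : ℝ)]
  have step1 : (((a * b * e : ℕ) : ℝ) ^ (omega ℂ / 3)) ^ N ≤
      tensorRank (matMulTensor ℂ (a ^ N) (b ^ N) (e ^ N)) := by
    have := rpow_omega_div_three_le_tensorRank ℂ hqN
    rwa [hcast, hpow] at this
  -- `R(⟨a^N, b^N, e^N⟩) ≤ ∑_J R(⟨∏ d_{J l}, …⟩)`
  have step2 : (tensorRank (matMulTensor ℂ (a ^ N) (b ^ N) (e ^ N)) : ℝ) ≤
      ∑ J : Fin N → Fin p, (tensorRank (matMulTensor ℂ (∏ l, d (J l)) (∏ l, d (J l))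
        (∏ l, d (J l))) : ℝ) := by
    exact_mod_cast tensorRank_matMulTensor_pow_le_of_restrictsTo_matMulDirectSum d hres N
  -- `R(⟨D_J, D_J, D_J⟩) ≤ C D_J^{ω+ε} = C ∏ₗ d_{J l}^{ω+ε}`
  have step3 : ∀ J : Fin N → Fin p,
      (tensorRank (matMulTensor ℂ (∏ l, d (J l)) (∏ l, d (J l)) (∏ l, d (J l))) : ℝ) ≤
        C * ∏ l, (d (J l) : ℝ) ^ (omega ℂ + ε) := fun J => by
    refine (hCk _ (hDJ J)).trans_eq ?_
    rw [Nat.cast_prod, Real.finsetProd_rpow _ _ fun l _ => (hdpos (J l)).le]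
  calc (((a * b * e : ℕ) : ℝ) ^ (omega ℂ / 3)) ^ N
      ≤ ∑ J : Fin N → Fin p, C * ∏ l, (d (J l) : ℝ) ^ (omega ℂ + ε) :=
        step1.trans (step2.trans (Finset.sum_le_sum fun J _ => step3 J))
    _ = C * (∑ i, (d i : ℝ) ^ (omega ℂ + ε)) ^ N := by
        rw [← Finset.mul_sum, Fintype.sum_pow]

end Summit.MatrixMultiplication.MatrixMultiplication.Theorems

end
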